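import Summits.ABC.ABC.Theses.FeketeScales
import Summits.ABC.ABC.Theorems.FeketeScalesScaleSubmultiplicativityNonBurstSubmult

/-!
# `(P) ∧ (W) ⟹ ScaleSubmultiplicativity` — the transfer of line SketchIdeator3 (crux stmt-ABC-2160)

Stub S7 `ScaleSubmultiplicativity.of_primitiveEnvelope_of_powerShapeSubmult` of the lead skeleton for the crux
`Summit.ABC.ABC.Theses.FeketeScales.ScaleSubmultiplicativity` (route `FeketeScales`, ABC/ABC), idea card
core-lattice-dichotomy (`LineComposition`).  Statement: if
* (P) PRIMITIVE SUB-POWER ENVELOPE — for some `θ ∈ [0,1)` and `B`, every abc triple that is NOT of power shape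
  (no two of `a, b, c` perfect `j`-th powers for one `j ≥ 2`) has `c ≤ e^B · rad · exp((log rad)^θ)`, and
* (W) the crux's G-free inequality holds on POWER-SHAPED triples (with `θ ∈ [0,1)`, `K > 0`, `R₀`),
then `ScaleSubmultiplicativity` holds, with `θ := max θ_P θ_W`, `K := max (16 e^B) K_W`, `R₀ := max 4 R₀_W`.

Proof: case split power-shape / not; on the power-shape side (W) itself, on the primitive side the landed rung
`ScaleSubmultiplicativity.nonBurst_submult` ("non-bursts are free": shadows `(1, 2^k - 1, 2^k)`, constant
`16 e^B`); both bounds are then relaxed to the common `(θ, K)` by monotonicity (`bound_mono`: for `R₁R₂ ≥ 3`,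
`log R₁R₂ ≥ 1`, so `x ↦ (log R₁R₂)^x` is monotone).  The hypothesis (P) ∧ (W) is strictly weaker than the
pointwise envelope for ALL triples (hypothesis of `SubmultOfRST`, stmt-ABC-10340): power-shaped bursts are
allowed provided they are shadowed.  Both (P) and (W) are open (registered stubs S5, S6 of the skeleton).
-/

-- `Summit.<Summit>.<Problem>` is the mandated summit-side namespace (CONVENTIONS §2); for the
-- single-conjunct summit `ABC` the two coincide, so the duplicate `ABC.ABC` is deliberate.
set_option linter.dupNamespace false

namespace Summit.ABC.ABC.Theorems

open Literature.NumberTheory.DiophantineGeometry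

/-- Monotonicity of the crux bound in the parameters: for `R₁R₂ ≥ 3` (so that `log R₁R₂ ≥ 1`) the bound
`K · exp((log R₁R₂)^θ) · c₁ c₂` is non-decreasing in `θ` and in `K ≥ 0`. [folklore] -/
theorem ScaleSubmultiplicativity.bound_mono {θ θ' K K' : ℝ} {R₁ R₂ c₁ c₂ : ℕ} {c : ℝ}
    (hθ : θ ≤ θ') (hK : K ≤ K') (hK0 : 0 ≤ K) (hR : 3 ≤ R₁ * R₂)
    (h : c ≤ K * Real.exp (Real.log ((R₁ : ℝ) * R₂) ^ θ) * c₁ * c₂) :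
    c ≤ K' * Real.exp (Real.log ((R₁ : ℝ) * R₂) ^ θ') * c₁ * c₂ := by
  have h3 : (3 : ℝ) ≤ (R₁ : ℝ) * R₂ := by exact_mod_cast hR
  have h1 : (1 : ℝ) ≤ Real.log ((R₁ : ℝ) * R₂) := by
    rw [← Real.log_exp 1]
    refine Real.log_le_log (Real.exp_pos 1) ?_
    have he := Real.exp_one_lt_d9
    linarith
  have h2 : Real.log ((R₁ : ℝ) * R₂) ^ θ ≤ Real.log ((R₁ : ℝ) * R₂) ^ θ' :=
    Real.rpow_le_rpow_of_exponent_le h1 hθ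
  have hexp : Real.exp (Real.log ((R₁ : ℝ) * R₂) ^ θ) ≤ Real.exp (Real.log ((R₁ : ℝ) * R₂) ^ θ') :=
    Real.exp_le_exp.mpr h2
  have hc : (0 : ℝ) ≤ (c₁ : ℝ) * c₂ := by positivity
  calc c ≤ K * Real.exp (Real.log ((R₁ : ℝ) * R₂) ^ θ) * c₁ * c₂ := h
    _ = K * Real.exp (Real.log ((R₁ : ℝ) * R₂) ^ θ) * ((c₁ : ℝ) * c₂) := by ring
    _ ≤ K' * Real.exp (Real.log ((R₁ : ℝ) * R₂) ^ θ') * ((c₁ : ℝ) * c₂) := by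
        refine mul_le_mul_of_nonneg_right ?_ hc
        exact mul_le_mul hK hexp (Real.exp_pos _).le (hK0.trans hK)
    _ = K' * Real.exp (Real.log ((R₁ : ℝ) * R₂) ^ θ') * c₁ * c₂ := by ring

/-- **`(P) ∧ (W) ⟹ ScaleSubmultiplicativity`** (transfer of line SketchIdeator3, card core-lattice-dichotomy,
stub S7 of the lead skeleton for crux stmt-ABC-2160).  If (P) every abc triple NOT of power shape satisfies the
sub-power envelope `c ≤ e^B · rad · exp((log rad)^θ)` (`0 ≤ θ < 1`) and (W) the crux's G-free inequality holds on
power-shaped triples, then `ScaleSubmultiplicativity` holds (`θ := max θ_P θ_W`, `K := max (16 e^B) K_W`,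
`R₀ := max 4 R₀_W`): power shapes by (W), the rest by the free rung `ScaleSubmultiplicativity.nonBurst_submult`,
both relaxed to the common parameters by `ScaleSubmultiplicativity.bound_mono`. [folklore] -/
theorem ScaleSubmultiplicativity.of_primitiveEnvelope_of_powerShapeSubmult :
    (∃ θ : ℝ, 0 ≤ θ ∧ θ < 1 ∧ ∃ B : ℝ, ∀ a b c : ℕ, IsABCTriple a b c →
      ¬ (∃ j : ℕ, 2 ≤ j ∧ ((∃ x y : ℕ, a = x ^ j ∧ b = y ^ j) ∨ (∃ x z : ℕ, a = x ^ j ∧ c = z ^ j) ∨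
          (∃ y z : ℕ, b = y ^ j ∧ c = z ^ j))) →
      (c : ℝ) ≤ Real.exp B * (rad a b c : ℝ) * Real.exp (Real.log (rad a b c : ℝ) ^ θ)) →
    (∃ θ : ℝ, 0 ≤ θ ∧ θ < 1 ∧ ∃ K : ℝ, 0 < K ∧ ∃ R₀ : ℕ, ∀ R₁ R₂ : ℕ, R₀ ≤ R₁ → R₀ ≤ R₂ →
      ∀ a b c : ℕ, IsABCTriple a b c →
      (∃ j : ℕ, 2 ≤ j ∧ ((∃ x y : ℕ, a = x ^ j ∧ b = y ^ j) ∨ (∃ x z : ℕ, a = x ^ j ∧ c = z ^ j) ∨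
          (∃ y z : ℕ, b = y ^ j ∧ c = z ^ j))) →
      rad a b c ≤ R₁ * R₂ →
      ∃ a₁ b₁ c₁ a₂ b₂ c₂ : ℕ, IsABCTriple a₁ b₁ c₁ ∧ rad a₁ b₁ c₁ ≤ R₁ ∧ IsABCTriple a₂ b₂ c₂ ∧
        rad a₂ b₂ c₂ ≤ R₂ ∧ (c : ℝ) ≤ K * Real.exp (Real.log ((R₁ : ℝ) * R₂) ^ θ) * c₁ * c₂) →
    Summit.ABC.ABC.Theses.FeketeScales.ScaleSubmultiplicativity := by
  rintro ⟨θP, hθP0, hθP1, B, hP⟩ ⟨θW, -, hθW1, KW, hKW, R₀W, hW⟩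
  refine ⟨max θP θW, max_lt hθP1 hθW1, max (16 * Real.exp B) KW, lt_max_of_lt_right hKW,
    max 4 R₀W, ?_⟩
  intro R₁ R₂ hR₁ hR₂ a b c habc hrad
  have hR₁4 : 4 ≤ R₁ := (le_max_left _ _).trans hR₁
  have hR₂4 : 4 ≤ R₂ := (le_max_left _ _).trans hR₂
  have hR3 : 3 ≤ R₁ * R₂ :=
    calc 3 ≤ 4 * 4 := by norm_num
      _ ≤ R₁ * R₂ := Nat.mul_le_mul hR₁4 hR₂4
  have h16 : (0 : ℝ) ≤ 16 * Real.exp B := by positivity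
  by_cases hps : ∃ j : ℕ, 2 ≤ j ∧ ((∃ x y : ℕ, a = x ^ j ∧ b = y ^ j) ∨
      (∃ x z : ℕ, a = x ^ j ∧ c = z ^ j) ∨ (∃ y z : ℕ, b = y ^ j ∧ c = z ^ j))
  · obtain ⟨a₁, b₁, c₁, a₂, b₂, c₂, h₁, hr₁, h₂, hr₂, hle⟩ :=
      hW R₁ R₂ ((le_max_right _ _).trans hR₁) ((le_max_right _ _).trans hR₂) a b c habc hps hrad
    exact ⟨a₁, b₁, c₁, a₂, b₂, c₂, h₁, hr₁, h₂, hr₂,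
      ScaleSubmultiplicativity.bound_mono (le_max_right _ _) (le_max_right _ _) hKW.le hR3 hle⟩
  · have henv := hP a b c habc hps
    obtain ⟨a₁, b₁, c₁, a₂, b₂, c₂, h₁, hr₁, h₂, hr₂, hle⟩ :=
      ScaleSubmultiplicativity.nonBurst_submult θP B hθP0 R₁ R₂ hR₁4 hR₂4 a b c habc hrad henv
    exact ⟨a₁, b₁, c₁, a₂, b₂, c₂, h₁, hr₁, h₂, hr₂,
      ScaleSubmultiplicativity.bound_mono (le_max_left _ _) (le_max_left _ _) h16 hR3 hle⟩

end Summit.ABC.ABC.Theorems
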